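import Summits.BirchSwinnertonDyer.BirchSwinnertonDyer.Theorems.SchneiderFreeAdditiveX3PoitouTateShaZModMuHolds
import Summits.BirchSwinnertonDyer.BirchSwinnertonDyer.Theorems.ThetaPartnerAtTwoSignedControlAtTwoShaThreeBaseH3Units
import Literature.NumberTheory.GaloisRepresentations.TateH2VanishingTwoAllFields
import Literature.NumberTheory.GaloisRepresentations.TateSpinLiftContinuousH2Proofs
import Literature.NumberTheory.GaloisRepresentations.TateSpinLiftContinuous
import HarnessLib

/-!
# Tate's theorem `H²(Γ_K, ℚ/ℤ) = 0` for EVERY number field, unconditional; the Patrikis lifting facts HOLD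
# (follow-through of the door-c4/c5/c6 Poitou–Tate lane; seat `bsd-schneider-door-c4` gen 21)

Cell `bsd-schneider-ideate`, route `SchneiderFreeAdditiveX3` (rung K1 door).  NOT a case of BSD and closes no
route item: a follow-through of the lane's Poitou–Tate theorems (as gen 20's
`SchneiderFreeAdditiveX3PoitouTateShaZModMuConsequences.lean`, which left exactly the `2`-primary part of
Tate's theorem for number fields WITHOUT `√-1`).  Beneficiary: the Galois-representation / Langlands lane
(`Patrikis2019_exists_lift_projective`, `Patrikis2019_exists_spinLift`, `Patrikis2019_exists_spinLift_of_continuous`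
are cite-only named facts consumed by `Summits/Langlands/…/Theses/K3SpinSixteen.lean` and
`K3KugaSatakeDescent.EvenSectorNotPolarized`).

The Literature reduction `TateH2VanishingTwoAllFields.lean` (this seat) proves Tate's theorem in cochain
form for every number field `K` from two named facts: `poitouTate_sha_zmod_mu` (all number fields) and
`poitouTate_three_realPlaces_injective K` (Milne I Thm. 4.10 (c)₃).  Both are tree THEOREMS:

* `PoitouTateReduction.poitouTate_sha_zmod_mu_holds` (door-c4 gen 20, p633946; on PT (ii)
  `poitouTate_sha_tateDual_holds`, door-c4 gen 19, itself on the idèle class formation of Route A);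
* `SignedEC.ShaThreeBrauer.poitouTate_three_realPlaces_injective_holds` (cell bsd-wall, K4 line
  `eulerchar`, p628282: `H³(Γ_F, F̄ˣ) = 0` from the same class formation).

Hence, unconditionally (axioms `propext`, `Classical.choice`, `Quot.sound`):

* `tate_twoCocycle_addCircle_split` — **Tate's theorem `H²(Γ_K, ℚ/ℤ) = 0` in cochain form for EVERY
  number field `K`** (Serre, Durham 1977, §6.1 Thm. 4): every locally constant `2`-cocycle
  `Γ_K × Γ_K → ℚ/ℤ` is the coboundary of a locally constant cochain;
* `tate_twoCocycle_addCircle_prime_split` — its `p`-torsion form `(H_p)(Γ_K)`, all `p`, all `K`;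
* `Patrikis2019_exists_lift_projective_holds`, `Patrikis2019_exists_spinLift_holds`,
  `Patrikis2019_exists_spinLift_of_continuous_holds` — the three lifting facts of
  `ProjectiveLifting.lean` / `TateSpinLift.lean` / `TateSpinLiftContinuous.lean` (Patrikis 2019, §2.1
  Theorem (Tate), Proposition and Remark) HOLD.

References: [SerreDurham1977] §6.1 Thm. 4, §6.5; [Harari2020] Cor. 18.17; [MilneADT2006] I Thm. 4.10 (c);
[Patrikis2019] §2.1.
-/

set_option autoImplicit false
-- the summit-side namespace `Summit.BirchSwinnertonDyer.BirchSwinnertonDyer.…` (summit = problem) trips this linter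
set_option linter.dupNamespace false

noncomputable section

namespace Summit.BirchSwinnertonDyer.BirchSwinnertonDyer.Theorems.SchneiderFreeAdditiveX3.PoitouTateReduction

open Literature.NumberTheory.GaloisRepresentations Literature.NumberTheory.GaloisCohomology
open Field Function NumberField
open Summit.BirchSwinnertonDyer.BirchSwinnertonDyer.Theorems.SignedEC.ShaThreeBrauer
  (poitouTate_three_realPlaces_injective_holds)

section Tate

/-- **Tate's theorem `H²(Γ_K, ℚ/ℤ) = 0` in cochain form, for EVERY number field `K`, unconditionally**
(Serre, Durham §6.1 Thm. 4: *"If `K` is a local or global field, `H²(G_K, ℚ/ℤ) = 0`"*): every locally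
constant `2`-cocycle `Γ_K × Γ_K → ℚ/ℤ` (trivial action) is the coboundary of a locally constant cochain —
`twoCocycle_addCircle_split_of_poitouTate_of_realThree` with both named facts discharged
(`poitouTate_sha_zmod_mu_holds`, `poitouTate_three_realPlaces_injective_holds`).
[cite: SerreDurham1977, §6.1 Thm. 4 (Tate)] [cite: Harari2020, Cor. 18.17] -/
theorem tate_twoCocycle_addCircle_split (K : Type) [Field K] [NumberField K]
    (f : absoluteGaloisGroup K → absoluteGaloisGroup K → AddCircle (1 : ℚ))
    (hf : IsLocallyConstant (Function.uncurry f))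
    (hcoc : ∀ σ τ υ, f σ τ + f (σ * τ) υ = f τ υ + f σ (τ * υ)) :
    ∃ b : absoluteGaloisGroup K → AddCircle (1 : ℚ), IsLocallyConstant b ∧
      ∀ σ τ, f σ τ + b (σ * τ) = b σ + b τ :=
  twoCocycle_addCircle_split_of_poitouTate_of_realThree (fun K _ _ => poitouTate_sha_zmod_mu_holds K) K
    (poitouTate_three_realPlaces_injective_holds K) f hf hcoc

/-- **`(H_p)(Γ_K)` for every prime `p` and every number field `K`, unconditionally** (the `p`-torsion
form: every locally constant `p`-torsion `2`-cocycle splits; the torsion hypothesis is not needed).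
[cite: SerreDurham1977, §6.5] -/
theorem tate_twoCocycle_addCircle_prime_split (K : Type) [Field K] [NumberField K] (p : ℕ)
    (g : absoluteGaloisGroup K → absoluteGaloisGroup K → AddCircle (1 : ℚ))
    (hg : IsLocallyConstant (Function.uncurry g))
    (hcoc : ∀ σ τ υ, g σ τ + g (σ * τ) υ = g τ υ + g σ (τ * υ)) (_hpg : ∀ σ τ, p • g σ τ = 0) :
    ∃ c : absoluteGaloisGroup K → AddCircle (1 : ℚ), IsLocallyConstant c ∧
      ∀ σ τ, g σ τ + c (σ * τ) = c σ + c τ :=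
  tate_twoCocycle_addCircle_split K g hg hcoc

end Tate

section Patrikis

/-- **The named fact `Patrikis2019_exists_lift_projective` HOLDS** (Patrikis 2019, §2.1 Theorem (Tate) =
arXiv Thm. 1.0.16 with Prop. 1.0.18 and Remark: every continuous projective representation of `Γ_F`,
`F` a number field, lifts with control of ramification) — `Patrikis2019_exists_lift_projective_of_H2_addCircle`
fed with Tate's theorem for every number field.
[cite: Patrikis2019, §2.1 Theorem (Tate) = arXiv Thm. 1.0.16, Prop. 1.0.18 and Remark] [cite: SerreDurham1977, §6.1 Thm. 4] -/
theorem Patrikis2019_exists_lift_projective_holds : Patrikis2019_exists_lift_projective :=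
  Patrikis2019_exists_lift_projective_of_H2_addCircle fun K _ _ f hf hcoc =>
    tate_twoCocycle_addCircle_split K f hf hcoc

/-- **The named fact `Patrikis2019_exists_spinLift` HOLDS** (Patrikis §2.1 Proposition and Remark for
`GSpin₆ ↠ SO₆`, via `Patrikis2019_exists_spinLift_of_lift_projective`).
[cite: Patrikis2019, §2.1 Proposition and Remark (= arXiv Prop. 1.0.18, Rem. 1.0.19)] -/
theorem Patrikis2019_exists_spinLift_holds : Patrikis2019_exists_spinLift :=
  Patrikis2019_exists_spinLift_of_lift_projective Patrikis2019_exists_lift_projective_holds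

/-- **The named fact `Patrikis2019_exists_spinLift_of_continuous` HOLDS** (the ramification-free spin
lift `∧²W ≅ ν ⊗ r` for a continuous `r : Γ_F → SO₆(ℚ̄_ℓ)`; Patrikis §2.1 Proposition = Conrad Prop. 5.3),
via the tree's `Patrikis2019_exists_spinLift_of_continuous_of_H2_addCircle` and Tate's theorem for
every number field. [cite: Patrikis2019, Ch. 2 §2.1, Proposition (= arXiv Prop. 1.0.18)] -/
theorem Patrikis2019_exists_spinLift_of_continuous_holds : Patrikis2019_exists_spinLift_of_continuous :=
  fun F _ _ ℓ _ r hJ hdet =>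
    Patrikis2019_exists_spinLift_of_continuous_of_H2_addCircle
      (fun K _ _ f hf hcoc => tate_twoCocycle_addCircle_split K f hf hcoc) F ℓ r hJ hdet

end Patrikis

end Summit.BirchSwinnertonDyer.BirchSwinnertonDyer.Theorems.SchneiderFreeAdditiveX3.PoitouTateReduction

end
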